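import Summits.QuantumAdvantage.QuantumAdvantage.Theorems.CubicForrelationNearExactIsExactAmmWalsh
import Summits.QuantumAdvantage.QuantumAdvantage.Theorems.CubicForrelationNearExactIsExactAmmCeilingQ
import Literature.Computability.QuantumComplexity.SignedForrelationGadget

/-!
# Corner-flat pairs of rank 4 (imbalance-4 almost-MM habitat AMM₂), I: the exact `Φ` formula

Negative-side (disprover lane, unit `b2b-cforr-disprove-g33`, 2026-08-23) companion of
`Negative/CornerFlatParity.lean` (rank 2) for the crux `CubicForrelation.NearExactIsExact`; part II
(`Negative/CornerFlatRankFourCeiling.lean`) derives the `15/16` ceiling off the isotropic sub-habitat.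

The RANK-4 CORNER-FLAT family on `n = a + (a+4)` bits: `f(x₁ ‖ x₂) = (u₁(x₁)·x₂)(u₂(x₁)·x₂) ⊕
(u₃(x₁)·x₂)(u₄(x₁)·x₂) ⊕ w(x₁)·x₂ ⊕ f₀(x₁)` (every slice an aligned quadratic of rank 4) against the
almost-MM sign form `(-1)^{g(y₁ ‖ y₂)} = (-1)^{y₁·φ(y₂)} (-1)^{h(y₂)}` whose fibres `φ⁻¹(x₁)` are the
16-point flats `w(x₁) + span(u₁, u₂, u₃, u₄)(x₁)`, parametrised by an argument `corner x₁ q`,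
`q = ((s,t),(s',t')) ∈ Bool⁴` (hypothesis `hc`; the file is definition-free).

* `cfr_walsh_signForm`, `cfr_fsum_signForm`, `cfr_ammWalsh` — the almost-MM Walsh/fibre identity of
  `stub_ammWalsh` for a second block of ANY size `m` resp. `a + 4`:
  `Φ(f,g) = 2^{-(2a+6)} ∑_{y₂} (-1)^{h(y₂)} W_{f(φ(y₂)‖·)}(y₂)`.
* `cfr_W_aligned4` — Walsh transform of a rank-4 aligned quadratic:
  `W(y) = 2^k/4 · (-1)^e ∑_{q ∈ Bool⁴} (-1)^{st} (-1)^{s't'} [y = corner q]` (no independence needed).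
* `cfr_forrelation_eq` — for the rank-4 corner-flat family (corner map injective on each fibre,
  `φ ∘ corner x₁ = x₁`): `Φ(f,g) = 2^{-(a+4)} ∑_{x₁} ∑_{q} (-1)^{h(corner x₁ q) ⊕ f₀(x₁) ⊕ st ⊕ s't'}` —
  so `Φ = 1 − #mismatches/2^{a+3}`, a mismatch being a corner where `h` disagrees with the dual
  quadratic `f₀ ⊕ st ⊕ s't'`.

Everything is over the standard three axioms.
-/

set_option linter.dupNamespace false -- D-0017: single-problem summit ⇒ `QuantumAdvantage.QuantumAdvantage` by design

noncomputable section

namespace Summit.QuantumAdvantage.QuantumAdvantage.Theorems.NearExactIsExact.Negative.CornerFlatRankFour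

open Finset
open Literature.Computability.QuantumComplexity
open Literature.Computability.QuantumComplexity.BuzetChailloux (bxor zeroVec twist_bxor_right
  twist_zeroVec_right bxor_eq_zeroVec_iff sum_twist_left)
open Literature.Computability.QuantumComplexity.DerivativeWalsh (W)
open Summit.QuantumAdvantage.QuantumAdvantage.Theorems.CubicForrelation.NearExactIsExact

variable {a m k : ℕ}

section Walsh

/-! ### The almost-MM Walsh/fibre identity with a second block of arbitrary size -/

/-- Dual sum of an almost-MM sign form, second block of size `m` (verbatim generalisation of
`aw_walsh_signForm`): `∑_y c (-1)^{x·y} (-1)^{g(y)} = 2^a ∑_{y₂ : φ(y₂) = x₁} c (-1)^{x₂·y₂} (-1)^{h(y₂)}`.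
[folklore] -/
theorem cfr_walsh_signForm (g : (Fin (a + m) → Bool) → Bool)
    (φ : (Fin m → Bool) → (Fin a → Bool)) (h : (Fin m → Bool) → Bool)
    (hg : ∀ (y₁ : Fin a → Bool) (y₂ : Fin m → Bool),
      signOf (g (Fin.append y₁ y₂)) = twist y₁ (φ y₂) * signOf (h y₂))
    (c : ℝ) (x₁ : Fin a → Bool) (x₂ : Fin m → Bool) :
    ∑ y : Fin (a + m) → Bool, c * twist (Fin.append x₁ x₂) y * signOf (g y) =
      (2 : ℝ) ^ a * ∑ y₂ : Fin m → Bool,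
        (if φ y₂ = x₁ then c * twist x₂ y₂ * signOf (h y₂) else 0) := by
  rw [sum_append, Finset.sum_comm, mul_sum]
  refine sum_congr rfl fun y₂ _ => ?_
  have orth : ∑ y₁ : Fin a → Bool, twist x₁ y₁ * twist y₁ (φ y₂) =
      if φ y₂ = x₁ then (2 : ℝ) ^ a else 0 := by
    have e : ∀ y₁ : Fin a → Bool, twist x₁ y₁ * twist y₁ (φ y₂) = twist y₁ (bxor x₁ (φ y₂)) := by
      intro y₁
      rw [BuzetChailloux.twist_bxor_right, twist_comm x₁ y₁]
    rw [sum_congr rfl fun y₁ _ => e y₁, BuzetChailloux.sum_twist_left]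
    refine if_congr ?_ rfl rfl
    rw [BuzetChailloux.bxor_eq_zeroVec_iff]
    exact eq_comm
  have e : ∀ y₁ : Fin a → Bool,
      c * twist (Fin.append x₁ x₂) (Fin.append y₁ y₂) * signOf (g (Fin.append y₁ y₂)) =
        c * twist x₂ y₂ * signOf (h y₂) * (twist x₁ y₁ * twist y₁ (φ y₂)) := by
    intro y₁
    rw [twist_append, hg]
    ring
  rw [sum_congr rfl fun y₁ _ => e y₁, ← mul_sum, orth]
  split_ifs <;> ring

/-- Unnormalised forrelation sum of an almost-MM sign form, second block of size `m`
(generalisation of `aw_fsum_signForm`). [folklore] -/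
theorem cfr_fsum_signForm (f g : (Fin (a + m) → Bool) → Bool)
    (φ : (Fin m → Bool) → (Fin a → Bool)) (h : (Fin m → Bool) → Bool)
    (hg : ∀ (y₁ : Fin a → Bool) (y₂ : Fin m → Bool),
      signOf (g (Fin.append y₁ y₂)) = twist y₁ (φ y₂) * signOf (h y₂)) :
    ∑ x : Fin (a + m) → Bool, ∑ y : Fin (a + m) → Bool,
        signOf (f x) * twist x y * signOf (g y) =
      (2 : ℝ) ^ a * ∑ y₂ : Fin m → Bool, signOf (h y₂) *
        ∑ x₂ : Fin m → Bool, signOf (f (Fin.append (φ y₂) x₂)) * twist x₂ y₂ := by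
  calc ∑ x : Fin (a + m) → Bool, ∑ y : Fin (a + m) → Bool,
        signOf (f x) * twist x y * signOf (g y)
      = ∑ x₁ : Fin a → Bool, ∑ x₂ : Fin m → Bool, (2 : ℝ) ^ a * ∑ y₂ : Fin m → Bool,
          (if φ y₂ = x₁ then signOf (f (Fin.append x₁ x₂)) * twist x₂ y₂ * signOf (h y₂) else 0) := by
        rw [sum_append]
        exact sum_congr rfl fun x₁ _ => sum_congr rfl fun x₂ _ => cfr_walsh_signForm g φ h hg _ x₁ x₂
    _ = (2 : ℝ) ^ a * ∑ x₂ : Fin m → Bool, ∑ x₁ : Fin a → Bool, ∑ y₂ : Fin m → Bool,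
          (if φ y₂ = x₁ then signOf (f (Fin.append x₁ x₂)) * twist x₂ y₂ * signOf (h y₂) else 0) := by
        rw [mul_sum, Finset.sum_comm]
        exact sum_congr rfl fun x₂ _ => (mul_sum _ _ _).symm
    _ = (2 : ℝ) ^ a * ∑ x₂ : Fin m → Bool, ∑ y₂ : Fin m → Bool,
          signOf (f (Fin.append (φ y₂) x₂)) * twist x₂ y₂ * signOf (h y₂) := by
        congr 1
        refine sum_congr rfl fun x₂ _ => ?_
        rw [Finset.sum_comm]
        refine sum_congr rfl fun y₂ _ => ?_
        rw [Finset.sum_ite_eq, if_pos (mem_univ _)]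
    _ = (2 : ℝ) ^ a * ∑ y₂ : Fin m → Bool, signOf (h y₂) *
          ∑ x₂ : Fin m → Bool, signOf (f (Fin.append (φ y₂) x₂)) * twist x₂ y₂ := by
        rw [Finset.sum_comm]
        congr 1
        refine sum_congr rfl fun y₂ _ => ?_
        rw [mul_sum]
        refine sum_congr rfl fun x₂ _ => ?_
        ring

/-- `√(2^{3(a+(a+4))}) = 2^a · 2^{2a+6}`. [folklore] -/
theorem cfr_sqrt_two_pow (a : ℕ) :
    Real.sqrt ((2 : ℝ) ^ (3 * (a + (a + 4)))) = (2 : ℝ) ^ a * (2 : ℝ) ^ (2 * a + 6) := by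
  rw [show (2 : ℝ) ^ (3 * (a + (a + 4))) = ((2 : ℝ) ^ a * (2 : ℝ) ^ (2 * a + 6)) ^ 2 by ring,
    Real.sqrt_sq (by positivity)]

/-- **Almost-MM Walsh/fibre identity, second block `a + 4`** (the imbalance-4 twin of
`stub_ammWalsh`): `Φ(f,g) = 2^{-(2a+6)} ∑_{y₂} (-1)^{h(y₂)} ∑_{x₂} (-1)^{f(φ(y₂)‖x₂)} (-1)^{x₂·y₂}`,
for an arbitrary map `φ : 𝔽₂^{a+4} → 𝔽₂^a`. [folklore] -/
theorem cfr_ammWalsh (f g : (Fin (a + (a + 4)) → Bool) → Bool)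
    (φ : (Fin (a + 4) → Bool) → (Fin a → Bool)) (h : (Fin (a + 4) → Bool) → Bool)
    (hg : ∀ (y₁ : Fin a → Bool) (y₂ : Fin (a + 4) → Bool),
      signOf (g (Fin.append y₁ y₂)) = twist y₁ (φ y₂) * signOf (h y₂)) :
    forrelation f g = ((2 : ℝ) ^ (2 * a + 6))⁻¹ *
      ∑ y₂ : Fin (a + 4) → Bool, signOf (h y₂) *
        ∑ x₂ : Fin (a + 4) → Bool, signOf (f (Fin.append (φ y₂) x₂)) * twist x₂ y₂ := by
  unfold forrelation
  rw [cfr_fsum_signForm f g φ h hg, cfr_sqrt_two_pow, mul_inv, mul_mul_mul_comm,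
    inv_mul_cancel₀ (by positivity : (2 : ℝ) ^ a ≠ 0), one_mul]

end Walsh

section Slice

/-! ### Walsh transform of a rank-4 aligned quadratic -/

variable (l : (Fin k → Bool) → (Fin k → Bool) → Bool)

/-- `(-1)^{x·(s·u)} = (-1)^{x·u}` if `s`, else `1`. -/
theorem cfr_twist_smul (x u : Fin k → Bool) (s : Bool) :
    twist x (fun j => s && u j) = if s then twist x u else 1 := by
  cases s with
  | false =>
    rw [show (fun j => false && u j) = zeroVec from rfl, twist_zeroVec_right]
    simp
  | true => simp

/-- The corner `corner q = w ⊕ s·u₁ ⊕ t·u₂ ⊕ s'·u₃ ⊕ t'·u₄` as an iterated `bxor`. -/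
theorem cfr_corner_eq {u₁ u₂ u₃ u₄ w : Fin k → Bool}
    (corner : (Bool × Bool) × (Bool × Bool) → (Fin k → Bool))
    (hcr : ∀ q j, corner q j =
      (w j ^^ (q.1.1 && u₁ j) ^^ (q.1.2 && u₂ j) ^^ (q.2.1 && u₃ j) ^^ (q.2.2 && u₄ j)))
    (q : (Bool × Bool) × (Bool × Bool)) :
    corner q = bxor (bxor (bxor (bxor w (fun j => q.1.1 && u₁ j)) (fun j => q.1.2 && u₂ j))
      (fun j => q.2.1 && u₃ j)) (fun j => q.2.2 && u₄ j) := by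
  funext j
  rw [hcr]

/-- `(-1)^{x·corner q} = (-1)^{x·w} ∏ (-1)^{x·(selected uᵢ)}`. -/
theorem cfr_twist_corner {u₁ u₂ u₃ u₄ w : Fin k → Bool}
    (corner : (Bool × Bool) × (Bool × Bool) → (Fin k → Bool))
    (hcr : ∀ q j, corner q j =
      (w j ^^ (q.1.1 && u₁ j) ^^ (q.1.2 && u₂ j) ^^ (q.2.1 && u₃ j) ^^ (q.2.2 && u₄ j)))
    (x : Fin k → Bool) (q : (Bool × Bool) × (Bool × Bool)) :
    twist x (corner q) = twist x w * (if q.1.1 then twist x u₁ else 1) *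
      (if q.1.2 then twist x u₂ else 1) * (if q.2.1 then twist x u₃ else 1) *
        (if q.2.2 then twist x u₄ else 1) := by
  rw [cfr_corner_eq corner hcr q, twist_bxor_right, twist_bxor_right, twist_bxor_right,
    twist_bxor_right, cfr_twist_smul, cfr_twist_smul, cfr_twist_smul, cfr_twist_smul]

/-- **Sign of a rank-4 aligned quadratic against a character**:
`(-1)^{c(x)} (-1)^{x·y} = (-1)^e/4 · ∑_{q} (-1)^{st} (-1)^{s't'} (-1)^{x·(corner q ⊕ y)}`
(twice the identity `(-1)^{pq} = (1 + (-1)^p + (-1)^q − (-1)^{p+q})/2`). [folklore] -/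
theorem cfr_signOf_aligned4 (hl : ∀ y x, signOf (l y x) = twist x y) {c : (Fin k → Bool) → Bool}
    {u₁ u₂ u₃ u₄ w : Fin k → Bool} {e : Bool}
    (hc : ∀ x, c x = ((l u₁ x && l u₂ x) ^^ (l u₃ x && l u₄ x) ^^ l w x ^^ e))
    (corner : (Bool × Bool) × (Bool × Bool) → (Fin k → Bool))
    (hcr : ∀ q j, corner q j =
      (w j ^^ (q.1.1 && u₁ j) ^^ (q.1.2 && u₂ j) ^^ (q.2.1 && u₃ j) ^^ (q.2.2 && u₄ j)))
    (x y : Fin k → Bool) :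
    signOf (c x) * twist x y = signOf e / 4 *
      ∑ q : (Bool × Bool) × (Bool × Bool),
        signOf (q.1.1 && q.1.2) * signOf (q.2.1 && q.2.2) * twist x (bxor (corner q) y) := by
  rw [hc, signOf_xor, signOf_xor, signOf_xor, ar_signOf_and, ar_signOf_and, hl, hl, hl, hl, hl]
  simp only [twist_bxor_right, cfr_twist_corner corner hcr, Fintype.sum_prod_type,
    Fintype.sum_bool, Bool.true_and, Bool.false_and, SgnForrMem.signOf_true, SgnForrMem.signOf_false,
    if_true, Bool.false_eq_true, if_false]
  ring

/-- **Walsh transform of a rank-4 aligned quadratic**: for `c(x) = (u₁·x)(u₂·x) ⊕ (u₃·x)(u₄·x) ⊕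
w·x ⊕ e`, `W_{(-1)^c}(y) = 2^k/4 · (-1)^e ∑_{q ∈ Bool⁴} (-1)^{st} (-1)^{s't'} [y = corner q]`
(character orthogonality; no independence of the `uᵢ` is needed). [folklore] -/
theorem cfr_W_aligned4 (hl : ∀ y x, signOf (l y x) = twist x y) {c : (Fin k → Bool) → Bool}
    {u₁ u₂ u₃ u₄ w : Fin k → Bool} {e : Bool}
    (hc : ∀ x, c x = ((l u₁ x && l u₂ x) ^^ (l u₃ x && l u₄ x) ^^ l w x ^^ e))
    (corner : (Bool × Bool) × (Bool × Bool) → (Fin k → Bool))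
    (hcr : ∀ q j, corner q j =
      (w j ^^ (q.1.1 && u₁ j) ^^ (q.1.2 && u₂ j) ^^ (q.2.1 && u₃ j) ^^ (q.2.2 && u₄ j)))
    (y : Fin k → Bool) :
    W (fun x => signOf (c x)) y = (2 : ℝ) ^ k / 4 * signOf e *
      ∑ q : (Bool × Bool) × (Bool × Bool),
        signOf (q.1.1 && q.1.2) * signOf (q.2.1 && q.2.2) * (if y = corner q then 1 else 0) := by
  simp only [W]
  rw [sum_congr rfl fun x _ => cfr_signOf_aligned4 l hl hc corner hcr x y, ← mul_sum,
    Finset.sum_comm]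
  have inner : ∀ q : (Bool × Bool) × (Bool × Bool),
      ∑ x : Fin k → Bool, signOf (q.1.1 && q.1.2) * signOf (q.2.1 && q.2.2) *
          twist x (bxor (corner q) y) =
        (2 : ℝ) ^ k * (signOf (q.1.1 && q.1.2) * signOf (q.2.1 && q.2.2) *
          (if y = corner q then 1 else 0)) := by
    intro q
    rw [← mul_sum, sum_twist_left]
    by_cases hq : corner q = y
    · rw [if_pos ((bxor_eq_zeroVec_iff _ _).mpr hq), if_pos hq.symm]; ring
    · rw [if_neg (fun h' => hq ((bxor_eq_zeroVec_iff _ _).mp h')), if_neg (fun h' => hq h'.symm)]; ring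
  rw [sum_congr rfl fun q _ => inner q, ← mul_sum]
  ring

end Slice

section Forrelation

/-! ### The exact `Φ` formula for rank-4 corner-flat pairs -/

/-- **Exact forrelation of a rank-4 corner-flat pair.**  `f(x₁‖x₂) = (u₁x₂)(u₂x₂) ⊕ (u₃x₂)(u₄x₂) ⊕
w·x₂ ⊕ f₀` slice-wise, `(-1)^g = (-1)^{y₁·φ(y₂)} (-1)^{h(y₂)}`, and the corner map `corner x₁ :
Bool⁴ → 𝔽₂^{a+4}` is injective with `φ(corner x₁ q) = x₁` (the fibres of `φ` are the corner flats).  Then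
`Φ(f,g) = 2^{-(a+4)} ∑_{x₁} ∑_{q=((s,t),(s',t'))} (-1)^{h(corner x₁ q) ⊕ f₀(x₁) ⊕ st ⊕ s't'}`; in
particular `Φ = 1 − (#mismatching corners)/2^{a+3}`. [folklore] -/
theorem cfr_forrelation_eq (l : (Fin (a + 4) → Bool) → (Fin (a + 4) → Bool) → Bool)
    (hl : ∀ y x, signOf (l y x) = twist x y)
    (u₁ u₂ u₃ u₄ w : (Fin a → Bool) → (Fin (a + 4) → Bool)) (f₀ : (Fin a → Bool) → Bool)
    (φ : (Fin (a + 4) → Bool) → (Fin a → Bool)) (h : (Fin (a + 4) → Bool) → Bool)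
    (f g : (Fin (a + (a + 4)) → Bool) → Bool)
    (hf : ∀ x₁ x₂, f (Fin.append x₁ x₂) =
      ((l (u₁ x₁) x₂ && l (u₂ x₁) x₂) ^^ (l (u₃ x₁) x₂ && l (u₄ x₁) x₂) ^^ l (w x₁) x₂ ^^ f₀ x₁))
    (hg : ∀ (y₁ : Fin a → Bool) (y₂ : Fin (a + 4) → Bool),
      signOf (g (Fin.append y₁ y₂)) = twist y₁ (φ y₂) * signOf (h y₂))
    (corner : (Fin a → Bool) → (Bool × Bool) × (Bool × Bool) → (Fin (a + 4) → Bool))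
    (hc : ∀ x₁ q j, corner x₁ q j =
      (w x₁ j ^^ (q.1.1 && u₁ x₁ j) ^^ (q.1.2 && u₂ x₁ j) ^^ (q.2.1 && u₃ x₁ j) ^^ (q.2.2 && u₄ x₁ j)))
    (hφ : ∀ x₁ q, φ (corner x₁ q) = x₁) (hinj : ∀ x₁, Function.Injective (corner x₁)) :
    forrelation f g = ((2 : ℝ) ^ (a + 4))⁻¹ *
      ∑ x₁ : Fin a → Bool, ∑ q : (Bool × Bool) × (Bool × Bool),
        signOf (h (corner x₁ q) ^^ f₀ x₁ ^^ (q.1.1 && q.1.2) ^^ (q.2.1 && q.2.2)) := by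
  classical
  rw [cfr_ammWalsh f g φ h hg]
  have hW : ∀ (x₁ : Fin a → Bool) (y : Fin (a + 4) → Bool),
      ∑ x₂ : Fin (a + 4) → Bool, signOf (f (Fin.append x₁ x₂)) * twist x₂ y =
        (2 : ℝ) ^ (a + 4) / 4 * signOf (f₀ x₁) * ∑ q : (Bool × Bool) × (Bool × Bool),
          signOf (q.1.1 && q.1.2) * signOf (q.2.1 && q.2.2) *
            (if y = corner x₁ q then 1 else 0) := by
    intro x₁ y
    have key := cfr_W_aligned4 l hl (c := fun x₂ => f (Fin.append x₁ x₂)) (fun x₂ => hf x₁ x₂)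
      (corner x₁) (hc x₁) y
    simpa only [W] using key
  have hbij : Function.Bijective
      (fun p : (Fin a → Bool) × ((Bool × Bool) × (Bool × Bool)) => corner p.1 p.2) := by
    rw [Fintype.bijective_iff_injective_and_card]
    refine ⟨fun p q hpq => ?_, ?_⟩
    · obtain ⟨p1, p2⟩ := p
      obtain ⟨q1, q2⟩ := q
      dsimp only at hpq
      have h1 : p1 = q1 := by rw [← hφ p1 p2, hpq, hφ]
      subst h1
      exact Prod.ext rfl (hinj p1 hpq)
    · simp only [Fintype.card_prod, Fintype.card_fun, Fintype.card_bool, Fintype.card_fin]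
      ring
  have hsum : ∀ G : (Fin (a + 4) → Bool) → ℝ,
      ∑ y, G y = ∑ x₁ : Fin a → Bool, ∑ q : (Bool × Bool) × (Bool × Bool), G (corner x₁ q) := by
    intro G
    rw [← Fintype.sum_prod_type']
    exact (Fintype.sum_bijective _ hbij (fun p => G (corner p.1 p.2)) G fun p => rfl).symm
  rw [hsum]
  have hterm : ∀ (x₁ : Fin a → Bool) (q : (Bool × Bool) × (Bool × Bool)),
      signOf (h (corner x₁ q)) *
          ∑ x₂ : Fin (a + 4) → Bool, signOf (f (Fin.append (φ (corner x₁ q)) x₂)) *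
            twist x₂ (corner x₁ q) =
        (2 : ℝ) ^ (a + 4) / 4 *
          signOf (h (corner x₁ q) ^^ f₀ x₁ ^^ (q.1.1 && q.1.2) ^^ (q.2.1 && q.2.2)) := by
    intro x₁ q
    rw [hφ, hW]
    have hind : ∀ q' : (Bool × Bool) × (Bool × Bool),
        (corner x₁ q = corner x₁ q') = (q = q') := fun q' => propext (hinj x₁).eq_iff
    simp only [hind]
    rw [Finset.sum_mul_boole, if_pos (mem_univ _), signOf_xor, signOf_xor, signOf_xor]
    ring
  rw [sum_congr rfl fun x₁ _ => sum_congr rfl fun q _ => hterm x₁ q]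
  simp only [← mul_sum]
  have h2 : (2 : ℝ) ^ (2 * a + 6) = (2 : ℝ) ^ (a + 4) / 4 * (2 : ℝ) ^ (a + 4) := by ring
  rw [h2, mul_inv, mul_comm ((2 : ℝ) ^ (a + 4) / 4)⁻¹, mul_assoc, inv_mul_cancel_left₀ (by positivity)]

end Forrelation

end Summit.QuantumAdvantage.QuantumAdvantage.Theorems.NearExactIsExact.Negative.CornerFlatRankFour

end
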